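import Literature.MathematicalPhysics.QuantumLattice.GrassmannEffectiveAction
import HarnessLib

/-!
# Integrating scale by scale: the iterated effective actions and the factorisation of the partition function

Topic `MathematicalPhysics/QuantumLattice`; the bookkeeping frame of the multiscale integration
(Benfatto–Giuliani–Mastropietro 2006, (2.12)–(2.14); Salmhofer 1999, §2.5.1 (2.105)–(2.106)) on top of
`GrassmannEffectiveAction.lean` (`effAction_add`: integrating `C₂` and then `C₁` is integrating `C₁ + C₂`).  For a
sequence of slice covariances `C 0, C 1, …` (integrated in this order) and an interaction `V`:

* `iterEffAction R C n V` — the effective action after the first `n` slices (`𝒱^{(n)}`: `iterEffAction C 0 V = V`,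
  `iterEffAction C (n+1) V = effAction (C n) (iterEffAction C n V)`);
* `effPartitionFn_add_of_isUnit` — the partition functions multiply:
  `∫dμ_{C₁+C₂} e^{-V} = ∫dμ_{C₂} e^{-V} · ∫dμ_{C₁} e^{-𝒱'}`, `𝒱' = effAction C₂ V` (the constant `e^{-βL²(F₀+e₁)}` of
  BGM (2.13) split off at every step);
* **`effAction_sum_range_eq_iterEffAction`**, **`effPartitionFn_sum_range_eq_prod`** — if every single-scale partition
  function `Z_j = ∫dμ_{C j} e^{-𝒱^{(j)}}` is a unit, then integrating the total covariance `Σ_{j<n} C j` at once gives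
  the iterated effective action, and the total partition function is the product `∏_{j<n} Z_j` (so `log Z = Σ_j log Z_j`:
  the free energy is the sum of the single-scale free energies of `GrassmannEffectivePartitionFnExp`).

Everything is proved; the one definition is `iterEffAction`; no named facts.

## Sources

G. Benfatto, A. Giuliani, V. Mastropietro, Ann. Henri Poincaré 7 (2006) 809–898, (2.12)–(2.14)
[`BenfattoGiulianiMastropietro2006`]; M. Salmhofer, *Renormalization* (1999), §2.5.1 (2.105)–(2.106), §4.3 (4.85)–(4.88)
[`Salmhofer1999`].
-/

noncomputable section

namespace Literature.MathematicalPhysics.QuantumLattice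

open GrassmannAlgebra Finset

variable (R : Type*) [CommRing R] [Algebra ℚ R] {Γ : Type*} [Fintype Γ]

/-- **The iterated effective actions** `𝒱^{(n)}`: `𝒱^{(0)} = V`, `𝒱^{(n+1)} = effAction (C n) 𝒱^{(n)}` — the slices
`C 0, C 1, …` are integrated in this order (BGM 2006, (2.12)–(2.14)). [cite: BenfattoGiulianiMastropietro2006, (2.13)-(2.14)] -/
def iterEffAction (C : ℕ → Matrix Γ Γ R) : ℕ → GrassmannAlgebra R Γ → GrassmannAlgebra R Γ
  | 0, V => V
  | n + 1, V => effAction R (C n) (iterEffAction C n V)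

variable {R}

/-- `𝒱^{(0)} = V`. [folklore] -/
@[simp] theorem iterEffAction_zero (C : ℕ → Matrix Γ Γ R) (V : GrassmannAlgebra R Γ) : iterEffAction R C 0 V = V := rfl

/-- `𝒱^{(n+1)} = effAction (C n) 𝒱^{(n)}`. [folklore] -/
theorem iterEffAction_succ (C : ℕ → Matrix Γ Γ R) (n : ℕ) (V : GrassmannAlgebra R Γ) :
    iterEffAction R C (n + 1) V = effAction R (C n) (iterEffAction R C n V) := rfl

/-- **The partition functions multiply along the semigroup**: if `Z₂ = ∫dμ_{C₂} e^{-V}` is a unit then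
`∫dμ_{C₁+C₂} e^{-V} = Z₂ · ∫dμ_{C₁} e^{-effAction C₂ V}` (Salmhofer 1999, (2.105) in the normalised convention; BGM 2006,
(2.13): the constants accumulate multiplicatively). [cite: Salmhofer1999, §2.5.1 (2.105)] -/
theorem effPartitionFn_add_of_isUnit (C₁ C₂ : Matrix Γ Γ R) (V : GrassmannAlgebra R Γ)
    (hZ₂ : IsUnit (effPartitionFn R C₂ V)) :
    effPartitionFn R (C₁ + C₂) V = effPartitionFn R C₂ V * effPartitionFn R C₁ (effAction R C₂ V) := by
  have hB : effBoltzmann R C₁ (effAction R C₂ V) = Ring.inverse (effPartitionFn R C₂ V) • effBoltzmann R (C₁ + C₂) V := by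
    rw [effBoltzmann_def, show grassmannExp (-effAction R C₂ V) =
        Ring.inverse (effPartitionFn R C₂ V) • effBoltzmann R C₂ V from ?_, map_smul, ← effBoltzmann_add]
    have h := effBoltzmann_eq_smul_grassmannExp R C₂ V hZ₂
    rw [h, smul_smul, Ring.inverse_mul_cancel _ hZ₂, one_smul]
  have hZ : effPartitionFn R C₁ (effAction R C₂ V) = Ring.inverse (effPartitionFn R C₂ V) * effPartitionFn R (C₁ + C₂) V := by
    show constPart R (effBoltzmann R C₁ (effAction R C₂ V)) = _
    rw [hB, map_smul, smul_eq_mul]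
    rfl
  rw [hZ, ← mul_assoc, Ring.mul_inverse_cancel _ hZ₂, one_mul]

/-- With nothing integrated the normalised partition function is `1` (for `V` without constant part). [folklore] -/
theorem effPartitionFn_zero_cov {V : GrassmannAlgebra R Γ} (hV0 : constPart R V = 0) : effPartitionFn R 0 V = 1 := by
  have hn : IsNilpotent (-V) := isNilpotent_of_constPart_eq_zero R (by rw [map_neg, hV0, neg_zero])
  rw [effPartitionFn, effBoltzmann_zero_cov, grassmannExp, IsNilpotent.map_exp hn, map_neg, hV0, neg_zero,
    IsNilpotent.exp_zero]

/-- **Integrating the first `n` slices at once is integrating them one by one**, and **the partition function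
factorises**: if `V` has no constant part and every single-scale partition function `Z_j = ∫dμ_{C j} e^{-𝒱^{(j)}}`,
`j < n`, is a unit, then `effAction (Σ_{j<n} C j) V = 𝒱^{(n)}`, `∫dμ_{Σ_{j<n} C j} e^{-V} = ∏_{j<n} Z_j` (a unit)
(BGM 2006, (2.12)–(2.14)). [cite: BenfattoGiulianiMastropietro2006, (2.13)-(2.14)] -/
theorem effAction_sum_range_eq_iterEffAction (C : ℕ → Matrix Γ Γ R) {V : GrassmannAlgebra R Γ} (hV0 : constPart R V = 0) :
    ∀ n : ℕ, (∀ j < n, IsUnit (effPartitionFn R (C j) (iterEffAction R C j V))) →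
      effAction R (∑ j ∈ range n, C j) V = iterEffAction R C n V ∧
        effPartitionFn R (∑ j ∈ range n, C j) V = ∏ j ∈ range n, effPartitionFn R (C j) (iterEffAction R C j V) ∧
        IsUnit (effPartitionFn R (∑ j ∈ range n, C j) V)
  | 0, _ => by
    rw [sum_range_zero, prod_range_zero, iterEffAction_zero, effAction_zero_cov R V hV0, effPartitionFn_zero_cov hV0]
    exact ⟨rfl, rfl, isUnit_one⟩
  | n + 1, h => by
    obtain ⟨hA, hZ, hunit⟩ := effAction_sum_range_eq_iterEffAction C hV0 n fun j hj => h j (Nat.lt_succ_of_lt hj)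
    have hn : IsUnit (effPartitionFn R (C n) (iterEffAction R C n V)) := h n (Nat.lt_succ_self n)
    refine ⟨?_, ?_, ?_⟩
    · rw [sum_range_succ, add_comm, effAction_add R _ _ V hunit, hA, iterEffAction_succ]
    · rw [sum_range_succ, add_comm, effPartitionFn_add_of_isUnit _ _ V hunit, hA, hZ, prod_range_succ]
    · rw [sum_range_succ, add_comm, effPartitionFn_add_of_isUnit _ _ V hunit, hA]
      exact hunit.mul hn

/-- **The total partition function is the product of the single-scale ones** (corollary; `log Z = Σ_j log Z_j`).
[cite: BenfattoGiulianiMastropietro2006, (2.13)-(2.14)] -/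
theorem effPartitionFn_sum_range_eq_prod (C : ℕ → Matrix Γ Γ R) {V : GrassmannAlgebra R Γ} (hV0 : constPart R V = 0)
    (n : ℕ) (h : ∀ j < n, IsUnit (effPartitionFn R (C j) (iterEffAction R C j V))) :
    effPartitionFn R (∑ j ∈ range n, C j) V = ∏ j ∈ range n, effPartitionFn R (C j) (iterEffAction R C j V) :=
  (effAction_sum_range_eq_iterEffAction C hV0 n h).2.1

/-- The iterated effective actions have no constant part (under the unit hypotheses). [folklore] -/
theorem constPart_iterEffAction (C : ℕ → Matrix Γ Γ R) {V : GrassmannAlgebra R Γ} (hV0 : constPart R V = 0) :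
    ∀ n : ℕ, (∀ j < n, IsUnit (effPartitionFn R (C j) (iterEffAction R C j V))) → constPart R (iterEffAction R C n V) = 0
  | 0, _ => hV0
  | n + 1, h => by
    rw [iterEffAction_succ]
    exact constPart_effAction R _ _ (h n (Nat.lt_succ_self n))

end Literature.MathematicalPhysics.QuantumLattice
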